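import Summits.ValiantsHypothesis.ValiantsHypothesis.Theses.TauConst

/-!
# Route TauConst — `Assembly` (stmt-ValiantsHypothesis-0334)

The assembly item of route `TauConst`: `(τ-conjecture ∧ constant elimination) →
(Bürgisser 2009: τ-conjecture ⇒ τ(per) not p-bounded, as an implication over `VP = VNP`) →
ValiantsHypothesis`, pure logic once unfolded (`ValiantsHypothesis` is `VP ℂ ≠ VNP ℂ`); candidate proof
on file since 2026-08-15 (`Proof_Assembly.lean`, rc 0), landed here under Theorems (prover-only).
Honest framing: an implication between OPEN statements; nothing here is progress on `VP ≠ VNP`.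
-/

set_option linter.dupNamespace false

namespace Summit.ValiantsHypothesis.ValiantsHypothesis.Theorems.TauConst

open Summit.ValiantsHypothesis.ValiantsHypothesis.Theses.TauConst

/-- **Item `Assembly` (stmt-ValiantsHypothesis-0334), PROVED** (pure logic). [folklore] -/
theorem assembly_proof : Assembly :=
  fun ⟨hτ, hce⟩ hB heq => hB hτ (hce heq)

end Summit.ValiantsHypothesis.ValiantsHypothesis.Theorems.TauConst
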